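import Mathlib
import Literature.Analysis.PDE.Wave1DPolynomialSolutions
import Summits.FinalStateConjecture.FinalStateConjecture.Theorems.PhotonSphereChannelsUniformPhotonSphereChannelsRPeelOperators

/-!
# Peeling, file 11: `t`-polynomial solutions from nilpotent tower data

Support file for `stub_peel` of the line `crum-peeling-recessive-tower` (crux
`UniformPhotonSphereChannelsR`, stmt-FinalStateConjecture-14074).  If `α, β` are smooth on an
open set `S` and `L_U^m α = L_U^m β = 0` on `S` (`L_U f = f'' − U f`), then

  `p(t, x) = Σ_{i < 2m+2} c_i(x) tⁱ`,  `c_{2j} = L_U^j α / (2j)!`, `c_{2j+1} = L_U^j β / (2j+1)!`,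

is `C²` on `ℝ × S`, solves `p_tt − p_xx + U p = 0` there (the tower recursion
`(i+1)(i+2) c_{i+2} = L_U c_i` and the vanishing of `c_{2m+2}, c_{2m+3}` on `S`), and has Cauchy
data `p(0, ·) = α`, `p_t(0, ·) = β` on `S` (`exists_towerSolution`).
-/

noncomputable section

-- the doubled `FinalStateConjecture` component is the tree's fixed summit/problem path
set_option linter.dupNamespace false

namespace Summit.FinalStateConjecture.FinalStateConjecture.Theorems.CrumPeelingRecessiveTower

open Set Filter Topology Finset
open scoped ContDiff

/-- Shifted derivative of a polynomial whose top coefficient vanishes: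
`d/dt Σ_{i<N} dᵢ tⁱ = Σ_{i<N} (i+1) d_{i+1} tⁱ` when `d_N = 0`. -/
theorem hasDerivAt_sum_pow_shift (N : ℕ) (d : ℕ → ℝ) (hd : d N = 0) (t : ℝ) :
    HasDerivAt (fun τ => ∑ i ∈ range N, d i * τ ^ i)
      (∑ i ∈ range N, ((i : ℝ) + 1) * d (i + 1) * t ^ i) t := by
  have h : HasDerivAt (fun τ => ∑ i ∈ range N, d i * τ ^ i)
      (∑ i ∈ range N, d i * ((i : ℝ) * t ^ (i - 1))) t :=
    HasDerivAt.fun_sum fun i _ => (hasDerivAt_pow i t).const_mul (d i)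
  refine h.congr_deriv ?_
  cases N with
  | zero => simp
  | succ n =>
    rw [Finset.sum_range_succ' (fun i => d i * ((i : ℝ) * t ^ (i - 1))), Finset.sum_range_succ, hd]
    simp only [Nat.cast_zero, zero_mul, mul_zero, add_zero, Nat.cast_succ, Nat.add_one_sub_one]
    refine Finset.sum_congr rfl fun i _ => ?_
    ring

/-- **`t`-polynomial solution from nilpotent tower data.**  See the module docstring. -/
theorem exists_towerSolution {U : ℝ → ℝ} {S : Set ℝ} (hS : IsOpen S) (hU : ContDiffOn ℝ ∞ U S)
    {m : ℕ} {α β : ℝ → ℝ} (hα : ContDiffOn ℝ ∞ α S) (hβ : ContDiffOn ℝ ∞ β S)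
    (hkα : EqOn ((fun (f : ℝ → ℝ) (x : ℝ) => iteratedDeriv 2 f x - U x * f x)^[m] α) (fun _ => 0) S)
    (hkβ : EqOn ((fun (f : ℝ → ℝ) (x : ℝ) => iteratedDeriv 2 f x - U x * f x)^[m] β) (fun _ => 0) S) :
    ∃ p : ℝ → ℝ → ℝ,
      ContDiffOn ℝ 2 (Function.uncurry p) {z : ℝ × ℝ | z.2 ∈ S} ∧
      (∀ t, ∀ x ∈ S,
        iteratedDeriv 2 (fun τ => p τ x) t - iteratedDeriv 2 (p t) x + U x * p t x = 0) ∧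
      (∃ (N : ℕ) (a : ℕ → ℝ → ℝ), ∀ t x, p t x = ∑ i ∈ Finset.range N, a i x * t ^ i) ∧
      (∀ x ∈ S, p 0 x = α x) ∧ (∀ x ∈ S, deriv (fun τ => p τ x) 0 = β x) := by
  set L : (ℝ → ℝ) → ℝ → ℝ := fun f x => iteratedDeriv 2 f x - U x * f x with hL
  -- the coefficients
  set γ : ℕ → ℝ → ℝ := fun i => if i % 2 = 0 then α else β with hγ
  have hγC : ∀ i, ContDiffOn ℝ ∞ (γ i) S := fun i => by
    simp only [hγ]; split_ifs <;> assumption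
  set c : ℕ → ℝ → ℝ := fun i x => (L^[i / 2] (γ i)) x / (i.factorial : ℝ) with hc
  have hcC : ∀ i, ContDiffOn ℝ ∞ (c i) S := fun i =>
    (contDiffOn_iterate_opL hS hU (i / 2) (hγC i)).div_const _
  -- the tower recursion `(i+1)(i+2) c_{i+2} = L c_i` (globally)
  have hrec : ∀ (i : ℕ) (x : ℝ), ((i : ℝ) + 1) * ((i : ℝ) + 2) * c (i + 2) x = L (c i) x := by
    intro i x
    have hdiv : (i + 2) / 2 = i / 2 + 1 := by omega
    have hγi : γ (i + 2) = γ i := by simp only [hγ, Nat.add_mod_right]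
    have hLc : L (c i) x = (L^[i / 2 + 1] (γ i)) x / (i.factorial : ℝ) := by
      simp only [hL, hc]
      rw [Function.iterate_succ_apply']
      have e : (fun x => (L^[i / 2] (γ i)) x / (i.factorial : ℝ))
          = fun x => (i.factorial : ℝ)⁻¹ * (L^[i / 2] (γ i)) x := by
        funext y; ring
      rw [e, iteratedDeriv_const_mul_field]
      ring
    rw [hLc]
    simp only [hc]
    rw [hγi, hdiv, Nat.factorial_succ, Nat.factorial_succ]
    push_cast
    have hf : (i.factorial : ℝ) ≠ 0 := by exact_mod_cast i.factorial_ne_zero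
    field_simp
    ring
  -- vanishing of the top coefficients on `S`
  have hkγ : ∀ i, m ≤ i / 2 → EqOn (L^[i / 2] (γ i)) (fun _ => 0) S := by
    intro i hi
    obtain ⟨j, hj⟩ := Nat.exists_eq_add_of_le hi
    rw [hj, add_comm, Function.iterate_add_apply]
    have hbase : EqOn (L^[m] (γ i)) (fun _ => 0) S := by
      simp only [hγ]; split_ifs
      · exact hkα
      · exact hkβ
    intro x hx
    rw [eqOn_iterate_opL hS U j hbase hx]
    have := iterate_opL_zero U j
    simp only [] at this
    rw [this]
  set N : ℕ := 2 * m + 2 with hN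
  have hcN : ∀ x ∈ S, c N x = 0 := fun x hx => by
    simp only [hc]; rw [hkγ N (by omega) hx]; simp
  have hcN1 : ∀ x ∈ S, c (N + 1) x = 0 := fun x hx => by
    simp only [hc]; rw [hkγ (N + 1) (by omega) hx]; simp
  -- the polynomial
  set p : ℝ → ℝ → ℝ := fun t x => ∑ i ∈ range N, c i x * t ^ i with hp
  -- `t`-derivatives on `S`
  have hpt : ∀ x ∈ S, ∀ t, HasDerivAt (fun τ => p τ x)
      (∑ i ∈ range N, ((i : ℝ) + 1) * c (i + 1) x * t ^ i) t := fun x hx t =>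
    hasDerivAt_sum_pow_shift N (fun i => c i x) (hcN x hx) t
  have hptt : ∀ x ∈ S, ∀ t, iteratedDeriv 2 (fun τ => p τ x) t = ∑ i ∈ range N, L (c i) x * t ^ i := by
    intro x hx t
    rw [iteratedDeriv_succ, iteratedDeriv_one]
    have e1 : deriv (fun τ => p τ x) = fun τ => ∑ i ∈ range N, (((i : ℝ) + 1) * c (i + 1) x) * τ ^ i := by
      funext τ; rw [(hpt x hx τ).deriv]
    rw [e1]
    have h2 := hasDerivAt_sum_pow_shift N (fun i => ((i : ℝ) + 1) * c (i + 1) x) (by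
      show ((N : ℝ) + 1) * c (N + 1) x = 0
      rw [hcN1 x hx, mul_zero]) t
    rw [h2.deriv]
    refine Finset.sum_congr rfl fun i _ => ?_
    rw [← hrec i x]
    push_cast
    ring
  -- `x`-derivatives on `S`
  have hpxx : ∀ t, ∀ x ∈ S, iteratedDeriv 2 (p t) x = ∑ i ∈ range N, iteratedDeriv 2 (c i) x * t ^ i :=
    fun t x hx => Literature.Analysis.PDE.iteratedDeriv_two_sum_mul_const hS (range N)
      (fun i _ => (hcC i).of_le (WithTop.coe_le_coe.2 le_top)) (fun i => t ^ i) hx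
  refine ⟨p, ?_, fun t x hx => ?_, ⟨N, c, fun t x => rfl⟩, fun x hx => ?_, fun x hx => ?_⟩
  · -- joint `C²`
    have : Function.uncurry p = fun z : ℝ × ℝ => ∑ i ∈ range N, c i z.2 * z.1 ^ i := by
      funext z; rfl
    rw [this]
    refine ContDiffOn.sum fun i _ => ContDiffOn.mul ?_ (contDiffOn_fst.pow _)
    exact ((hcC i).of_le (WithTop.coe_le_coe.2 le_top)).comp contDiffOn_snd fun z hz => hz
  · -- the equation
    rw [hptt x hx t, hpxx t x hx]
    simp only [hp, hL]
    rw [Finset.mul_sum, ← Finset.sum_sub_distrib, ← Finset.sum_add_distrib]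
    refine Finset.sum_eq_zero fun i _ => ?_
    ring
  · -- position data
    simp only [hp]
    rw [hN, show 2 * m + 2 = (2 * m + 1) + 1 by ring, Finset.sum_range_succ']
    simp only [pow_zero, mul_one, ne_eq, Nat.add_eq_zero_iff, one_ne_zero, and_false,
      not_false_eq_true, zero_pow, mul_zero, Finset.sum_const_zero, zero_add]
    simp [hc, hγ]
  · -- velocity data
    rw [(hpt x hx 0).deriv, hN, show 2 * m + 2 = (2 * m + 1) + 1 by ring, Finset.sum_range_succ']
    simp only [pow_zero, mul_one, ne_eq, Nat.add_eq_zero_iff, one_ne_zero, and_false,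
      not_false_eq_true, zero_pow, mul_zero, Finset.sum_const_zero, zero_add, Nat.cast_zero]
    simp [hc, hγ]

/-- Registered sub-goal `peel_sumPowShift` of `stub_peel` (verbatim signature): the shifted derivative of a polynomial with vanishing top coefficient. -/
theorem peel_sumPowShift : ∀ (N : ℕ) (d : ℕ → ℝ), d N = 0 → ∀ t : ℝ, HasDerivAt (fun τ => Finset.sum (Finset.range N) (fun i => d i * τ ^ i)) (Finset.sum (Finset.range N) (fun i => ((i : ℝ) + 1) * d (i + 1) * t ^ i)) t :=
  fun N d hd t => hasDerivAt_sum_pow_shift N d hd t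

end Summit.FinalStateConjecture.FinalStateConjecture.Theorems.CrumPeelingRecessiveTower
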